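import Mathlib
import HarnessLib
import HarnessLib.Audit
import Summits.Langlands.Statement
import Summits.Langlands.Langlands.Theses.SeedParityLadder
import Summits.Langlands.Langlands.Theses.PolyhedralTypeLadder
import Literature.NumberTheory.Automorphic.StrongArtinGL2
import Literature.NumberTheory.GaloisRepresentations.ProjectiveTypeSolvable

/-!
# BC3 birth skeleton — crux `SolvableArtinTypeAvatars` (SOLV) of the lens-1-g21 child route `PolyhedralTypeLadder`
# (cutting MIX = `Summit.Langlands.Langlands.Theses.SeedParityLadder.MaassTypeSeedAvatars` stmt-Langlands-27036 by solvable Artin type up to twist)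

Line «solvable descent → Artin coefficient transport» (memo §3, line card `birth_SOLV.md`).  Until the route is born the crux is a LOCAL verbatim copy of the
route.json text (namespace `…Cruxes.SolvableArtinTypeAvatars.Birth`); after birth the writer/lead swaps the local `def SolvableArtinTypeAvatars` for the tree decl `Summit.Langlands.Langlands.Theses.PolyhedralTypeLadder.SolvableArtinTypeAvatars` (same text ⇒ the
composition still elaborates; file `birth_SOLV.afterbirth.lean`) and registers it as `Cruxes/SolvableArtinTypeAvatars/Lines/birth.lean`.

Stubs (genuine lemmas of the line; sorries ONLY here):
  stub₁ `stub_solvableArtinDescent` (1369 chars; L-sized; PRINT as a method, not as one theorem): for an L-algebraic cuspidal π on GL₂/K of solvable Artin type up to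
         twist (the dial D, verbatim), there are an ALGEBRAIC Hecke character χ' of K and an Artin representation σ : Γ_K → GL₂(ℂ) (`FramedArtinRep K 2`) such that at almost
         every v: σ is unramified and its arithmetic-Frobenius charpoly is the Satake polynomial of the χ'-twisted parameter of π.  Engine = Langlands–Tunnell bootstrapping
         read DOWN the solvable tower M = M_r ⊃ … ⊃ M_0 = K (cyclic prime-degree layers): at the top BC_M(π ⊗ χ) = ψ₁ ⊞ ψ₂ is π(ψ₁ ⊕ ψ₂); at a layer where the descended
         form is Eisensteinian/induced use Labesse–Langlands (automorphic induction ↔ Ind of the Galois side), at a cuspidal layer use cyclic descent + the fibre theorem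
         (Arthur–Clozel Ch. 3 Thm 6.2; Rajan 2002 Thm 2 [corpus:paper:doi-10-4310-mrl-2002-v9-n4-a9 p.3]: fibres differ by a character of the layer) and the (B)-direction
         strong Artin for the solvable σ found so far (tree named fact `Literature.NumberTheory.Automorphic.strongArtin_of_isSolvable`, Langlands 1980 §3 / Tunnell 1981) with
         Jacquet–Shalika to compare; χ' = χ⁻¹ · (finite order) stays algebraic.  Galois bookkeeping: Klein (`projectiveType_of_isIrreducible_of_isSolvable'`, proved).
  stub₂ `stub_artinAvatarTransport` (976 chars; M-sized; tree-adjacent): from (χ', σ) as above to a semisimple ℓ-adic avatar of P: transport σ along ι⁻¹ to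
         `PadicAlgCl ℓ` (finite image, open kernel: `FramedGaloisRep.exists_map_of_isOpen_ker` / `exists_complex_model_of_isOpen_ker`, ArtinRepCoefficientTransport), twist by the
         ℓ-adic avatar of χ'⁻¹ (`HeckeCharacter.IsAlgebraic.exists_lAdic`), semisimplify if needed (`FramedGaloisRep.exists_semisimplification`), and match
         `arithFrobPolyOfSatake ι q 1 α` with the transported Satake polynomial (`arithFrobPolyOfSatake_one_eq_prod_map`, `hasFrobCharpolyAt_twist_of_eq_prod` — the
         normalisation check is the content).
  Plan-only BC5 rung `stub_rung_dihedralDescent` (1394 chars): stub₁ restricted to witnesses of degree [M:K] ≤ 2 (g = 2, DIHEDRAL/monomial type: π ⊗ χ = AI_{M/K}(ψ₁) —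
         Labesse–Langlands 1979; the census's «dihedral sub-box PRINT»): the first rung of the ladder, M-sized, outside S's known regime (Maass-type CM Hilbert forms of
         weight one are in no proved case of MIX) and exercising the lever (descent along one quadratic layer).  Not used by the composition (it is the d = 2 case of stub₁).
-/

set_option linter.dupNamespace false
set_option linter.unreachableTactic false
set_option linter.unusedTactic false
set_option linter.unusedVariables false
set_option maxHeartbeats 400000

namespace Summit.Langlands.Langlands.Cruxes.SolvableArtinTypeAvatars.Birth
open scoped BigOperators Topology Manifold Classical MeasureTheory ProbabilityTheory Matrix InnerProductSpace ComplexConjugate ContinuousMap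
open Filter Set Function TopologicalSpace MeasureTheory
open Literature.NumberTheory.Automorphic Literature.NumberTheory.GaloisRepresentations

/-- An irreducible `ℚ̄_ℓ`-representation is semisimple. [folklore] (node kernel, repeated so the file is self-contained) -/
theorem isSemisimple_of_isIrreducible {K : Type} [Field K] {ℓ : ℕ} [Fact ℓ.Prime] {n : ℕ}
    (ρ : FramedGaloisRep K (PadicAlgCl ℓ) n) (h : ρ.toGaloisRep.IsIrreducible) : ρ.toGaloisRep.IsSemisimple := by
  haveI := h
  change ComplementedLattice _
  infer_instance

/-- stub₁ text as a Prop (so probes can name it). -/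
def SolvableArtinDescent : Prop :=
  ∀ (K : Type) [Field K] [NumberField K] (hcpt : Literature.NumberTheory.Automorphic.isCompact_glFiniteIntegralLevel 2 K) (π : Literature.NumberTheory.Automorphic.CuspidalAutomorphicRepData 2 K hcpt), π.1.IsLAlgebraic → (∃ (χ : Literature.NumberTheory.GaloisRepresentations.HeckeCharacter K) (M : Type) (_ : Field M) (_ : NumberField M) (_ : Algebra K M) (ψ₁ ψ₂ : Literature.NumberTheory.GaloisRepresentations.HeckeCharacter M), IsGalois K M ∧ IsSolvable (M ≃ₐ[K] M) ∧ χ.IsAlgebraic ∧ ψ₁.IsFiniteOrder ∧ ψ₂.IsFiniteOrder ∧ ∀ᶠ Q : IsDedekindDomain.HeightOneSpectrum (NumberField.RingOfIntegers M) in cofinite, ∀ (v : IsDedekindDomain.HeightOneSpectrum (NumberField.RingOfIntegers K)) (α : Multiset ℂ), Q.asIdeal.under (NumberField.RingOfIntegers K) = v.asIdeal → π.1.HasSatakeParamAt v α → (α.map (χ.valueAtUniformizer v * ·)).map (· ^ Q.asIdeal.inertiaDeg (NumberField.RingOfIntegers K)) = {ψ₁.valueAtUniformizer Q, ψ₂.valueAtUniformizer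 Q}) → ∃ (χ' : Literature.NumberTheory.GaloisRepresentations.HeckeCharacter K) (σ : Literature.NumberTheory.GaloisRepresentations.FramedArtinRep K 2), χ'.IsAlgebraic ∧ ∀ᶠ v : IsDedekindDomain.HeightOneSpectrum (NumberField.RingOfIntegers K) in cofinite, ∃ α : Multiset ℂ, π.1.HasSatakeParamAt v α ∧ σ.IsUnramifiedAt v ∧ σ.HasFrobCharpolyAt v (Literature.NumberTheory.Automorphic.satakePolynomial (α.map (χ'.valueAtUniformizer v * ·)))

/-- stub₂ text as a Prop. -/
def ArtinAvatarTransport : Prop :=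
  ∀ (K : Type) [Field K] [NumberField K] (hcpt : Literature.NumberTheory.Automorphic.isCompact_glFiniteIntegralLevel 2 K) (P : Literature.NumberTheory.Automorphic.AutomorphicRepData (Literature.NumberTheory.Automorphic.AutomorphyDatum.gl 2 K hcpt)) (χ' : Literature.NumberTheory.GaloisRepresentations.HeckeCharacter K) (σ : Literature.NumberTheory.GaloisRepresentations.FramedArtinRep K 2), χ'.IsAlgebraic → (∀ᶠ v : IsDedekindDomain.HeightOneSpectrum (NumberField.RingOfIntegers K) in cofinite, ∃ α : Multiset ℂ, P.HasSatakeParamAt v α ∧ σ.IsUnramifiedAt v ∧ σ.HasFrobCharpolyAt v (Literature.NumberTheory.Automorphic.satakePolynomial (α.map (χ'.valueAtUniformizer v * ·)))) → ∀ (ℓ : ℕ) [Fact ℓ.Prime] (ι : PadicAlgCl ℓ ≃+* ℂ), ∃ ρ : Literature.NumberTheory.GaloisRepresentations.FramedGaloisRep K (PadicAlgCl ℓ) 2, ρ.toGaloisRep.IsSemisimple ∧ ∀ᶠ v : IsDedekindDomain.HeightOneSpectrum (NumberField.RingOfIntegers K) in cofinite, Summit.Langlands.SatakeFrobCompatibleAt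 ι P ρ v

/-- BC5 plan-only rung text as a Prop (d = 2: dihedral/monomial descent). -/
def DihedralDescentRung : Prop :=
  ∀ (K : Type) [Field K] [NumberField K] (hcpt : Literature.NumberTheory.Automorphic.isCompact_glFiniteIntegralLevel 2 K) (π : Literature.NumberTheory.Automorphic.CuspidalAutomorphicRepData 2 K hcpt), π.1.IsLAlgebraic → (∃ (χ : Literature.NumberTheory.GaloisRepresentations.HeckeCharacter K) (M : Type) (_ : Field M) (_ : NumberField M) (_ : Algebra K M) (ψ₁ ψ₂ : Literature.NumberTheory.GaloisRepresentations.HeckeCharacter M), IsGalois K M ∧ IsSolvable (M ≃ₐ[K] M) ∧ Module.finrank K M ≤ 2 ∧ χ.IsAlgebraic ∧ ψ₁.IsFiniteOrder ∧ ψ₂.IsFiniteOrder ∧ ∀ᶠ Q : IsDedekindDomain.HeightOneSpectrum (NumberField.RingOfIntegers M) in cofinite, ∀ (v : IsDedekindDomain.HeightOneSpectrum (NumberField.RingOfIntegers K)) (α : Multiset ℂ), Q.asIdeal.under (NumberField.RingOfIntegers K) = v.asIdeal → π.1.HasSatakeParamAt v α → (α.map (χ.valueAtUniformizer v * ·)).map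 (· ^ Q.asIdeal.inertiaDeg (NumberField.RingOfIntegers K)) = {ψ₁.valueAtUniformizer Q, ψ₂.valueAtUniformizer Q}) → ∃ (χ' : Literature.NumberTheory.GaloisRepresentations.HeckeCharacter K) (σ : Literature.NumberTheory.GaloisRepresentations.FramedArtinRep K 2), χ'.IsAlgebraic ∧ ∀ᶠ v : IsDedekindDomain.HeightOneSpectrum (NumberField.RingOfIntegers K) in cofinite, ∃ α : Multiset ℂ, π.1.HasSatakeParamAt v α ∧ σ.IsUnramifiedAt v ∧ σ.HasFrobCharpolyAt v (Literature.NumberTheory.Automorphic.satakePolynomial (α.map (χ'.valueAtUniformizer v * ·)))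

/-- **stub₁** — solvable Artin DESCENT (Langlands–Tunnell read downwards; L-sized; print method). -/
theorem stub_solvableArtinDescent : SolvableArtinDescent := by
  sorry

/-- **stub₂** — Artin coefficient TRANSPORT to a semisimple ℓ-adic avatar (M-sized; tree-adjacent). -/
theorem stub_artinAvatarTransport : ArtinAvatarTransport := by
  sorry

/-- **BC5 rung (plan-only)** — the d = 2 (dihedral) case of stub₁; first prover target of the line. -/
theorem stub_rung_dihedralDescent : DihedralDescentRung := by
  sorry

/-- The rung IS the d ≤ 2 restriction of stub₁ (so closing stub₁ closes it; stated to make the ladder explicit). -/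
theorem dihedralDescentRung_of_descent (h : SolvableArtinDescent) : DihedralDescentRung := by
  intro K _ _ hcpt π hL hd
  obtain ⟨χ, M, _, _, _, ψ₁, ψ₂, hG, hS, -, hχ, h₁, h₂, hrel⟩ := hd
  exact h K hcpt π hL ⟨χ, M, _, _, _, ψ₁, ψ₂, hG, hS, hχ, h₁, h₂, hrel⟩

/-- COMPOSITION — concludes the crux `SolvableArtinTypeAvatars` BY NAME from the two stubs (real proof, no sorry).  The `subst` line is the check that the parent's SeedBox
hypothesis pins `n = 2`; the `exact h₂ …` line checks that stub₁'s output clause is LITERALLY stub₂'s input clause. -/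
theorem solvableArtinTypeAvatars_of (h₁ : SolvableArtinDescent) (h₂ : ArtinAvatarTransport) : Summit.Langlands.Langlands.Theses.PolyhedralTypeLadder.SolvableArtinTypeAvatars := by
  intro K _ _ n hcpt hn π hL hbox hnh hsb hd h2 h3 ℓ _ ι
  obtain ⟨hn2, -⟩ := hsb
  subst hn2
  obtain ⟨χ', σ, hχ', hσ⟩ := h₁ K hcpt π hL hd
  exact h₂ K hcpt π.1 χ' σ hχ' hσ ℓ ι

theorem solvableArtinTypeAvatars_holds_of_stubs : Summit.Langlands.Langlands.Theses.PolyhedralTypeLadder.SolvableArtinTypeAvatars :=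
  solvableArtinTypeAvatars_of stub_solvableArtinDescent stub_artinAvatarTransport

/-- NON-VACUITY of the level binder (critic row 227 y3 pattern): `hcpt` is dischargeable over every number field. -/
example (K : Type) [Field K] [NumberField K] : Literature.NumberTheory.Automorphic.isCompact_glFiniteIntegralLevel 2 K :=
  Literature.NumberTheory.Automorphic.isCompact_glFiniteIntegralLevel_holds 2 K

/-! ## Per-stub probes (fail_if_success: rc 0 ⇒ every cheap attempt FAILED) -/

-- S0: stub₁ alone ↛ crux
example : True := by
  fail_if_success
    have : SolvableArtinDescent → Summit.Langlands.Langlands.Theses.PolyhedralTypeLadder.SolvableArtinTypeAvatars := by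
      first | exact fun h => h | (intros; assumption) | (intros; trivial) | tauto
  trivial

-- S1: stub₂ alone ↛ crux
example : True := by
  fail_if_success
    have : ArtinAvatarTransport → Summit.Langlands.Langlands.Theses.PolyhedralTypeLadder.SolvableArtinTypeAvatars := by
      first | exact fun h => h | (intros; assumption) | (intros; trivial) | tauto
  trivial

-- S2: stub₁ ↛ Langlands
example : True := by
  fail_if_success
    have : SolvableArtinDescent → _root_.Langlands := by
      first | exact fun h => h | (intros; assumption) | (intros; trivial) | tauto
  trivial

-- S3: stub₂ ↛ Langlands
example : True := by
  fail_if_success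
    have : ArtinAvatarTransport → _root_.Langlands := by
      first | exact fun h => h | (intros; assumption) | (intros; trivial) | tauto
  trivial

-- S4: stub₁ not cheap outright
example : True := by
  fail_if_success
    have : SolvableArtinDescent := by
      first | exact fun h => h | (intros; assumption) | (intros; trivial) | tauto
  trivial

-- S5: stub₂ not cheap outright
example : True := by
  fail_if_success
    have : ArtinAvatarTransport := by
      first | exact fun h => h | (intros; assumption) | (intros; trivial) | tauto
  trivial

-- S6: crux ↛ stub₁ cheaply (stub₁ is not the crux reworded: no hull hypotheses, conclusion an Artin rep over ℂ)
example : True := by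
  fail_if_success
    have : Summit.Langlands.Langlands.Theses.PolyhedralTypeLadder.SolvableArtinTypeAvatars → SolvableArtinDescent := by
      first | exact fun h => h | (intros; assumption) | (intros; trivial) | tauto
  trivial

-- S7: crux ↛ MIX (tree) cheaply — the cell is a proper restriction
example : True := by
  fail_if_success
    have : Summit.Langlands.Langlands.Theses.PolyhedralTypeLadder.SolvableArtinTypeAvatars → Summit.Langlands.Langlands.Theses.SeedParityLadder.MaassTypeSeedAvatars := by
      first | exact fun h => h | (intros; assumption) | (intros; trivial) | tauto
  trivial

-- S8: rung not cheap outright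
example : True := by
  fail_if_success
    have : DihedralDescentRung := by
      first | exact fun h => h | (intros; assumption) | (intros; trivial) | tauto
  trivial

-- S9: rung ↛ stub₁ cheaply (d ≤ 2 is a proper sub-case)
example : True := by
  fail_if_success
    have : DihedralDescentRung → SolvableArtinDescent := by
      first | exact fun h => h | (intros; assumption) | (intros; trivial) | tauto
  trivial

-- S10: rung ↛ crux
example : True := by
  fail_if_success
    have : DihedralDescentRung → Summit.Langlands.Langlands.Theses.PolyhedralTypeLadder.SolvableArtinTypeAvatars := by
      first | exact fun h => h | (intros; assumption) | (intros; trivial) | tauto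
  trivial

-- S11: the (B)-direction fact strongArtin_of_isSolvable ↛ stub₁ cheaply ((A) ≠ (B))
example : True := by
  fail_if_success
    have : Literature.NumberTheory.Automorphic.strongArtin_of_isSolvable → SolvableArtinDescent := by
      first | exact fun h => h | (intros; assumption) | (intros; trivial) | tauto
  trivial

end Summit.Langlands.Langlands.Cruxes.SolvableArtinTypeAvatars.Birth
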